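import Summits.AnomalousDissipation.AnomalousDissipation.Theorems.BaireTransferRobustLoudUpgradeStubLsFamilyPeriodicA

/-!
# Stub `stub_lsFamilyPeriodic` (crux stmt-AnomalousDissipation-1144, companion c3), part B: realisation of lattice solutions near
# the orbit (`witness_of_latticeSol`, the tail of `TimePeriodicLattice.persists_main` verbatim) and the KERNEL of the free-period
# linearisation under simple degeneracy (`ker_decomp`: lattice solutions of `τ⁻¹∂ₛh + L₀h + B(x₀,h) + B(h,x₀) = −μ ∂ₛx₀` are real
# combinations of the phase vector `g` and the state vector `k_v`); registered ending `lsFamilyPeriodic_partB` (the kernel is a line,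
# abstract).  Pure proof file; notations verbatim from `PeriodicNSOrbitPersistsProofs`.  Refs: Iooss 1972 §3; Henry 1981 Thm. 8.3.2.
-/


-- `Summit.<Summit>.<Problem>` is the tree's mandated summit-side namespace (CONVENTIONS §2); for this
-- single-conjunct summit the two coincide, so the duplicate is deliberate.
set_option linter.dupNamespace false

noncomputable section

open scoped BigOperators Topology ENNReal NNReal ComplexConjugate
open Filter Set Function MeasureTheory UnitAddTorus

namespace Summit.AnomalousDissipation.AnomalousDissipation.Theorems.RobustLoudUpgrade.LsFamilyPeriodic

open Literature.Analysis.FunctionSpaces Literature.Analysis.FunctionSpaces.Torus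
open Literature.Analysis.FunctionSpaces.EuclideanSpace
open Literature.Analysis.FluidPDE
open Literature.Analysis.FluidPDE.ScalarFourier
open Literature.Analysis.FluidPDE.TimePeriodicLattice
open Summit.AnomalousDissipation.AnomalousDissipation.Theses.BaireTransfer

-- NOTATION START
/-- Local notation: the parabolic weight `Λ(n, k) = |n| + |k|²`. -/
local notation:max "Λ" m:max => (|((Prod.fst m : ℤ) : ℝ)| + freqNormSq (Prod.snd m))

/-- Local notation: the convective symbol on `ℤ × ℤ³` (as in `TimePeriodicNSLattice`). -/
local notation:max "𝐍[" a ", " b "]" m:max =>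
  (WithLp.toLp 2 (fun p : Fin 3 => ∑ j : Fin 3, ∑' m' : ℤ × (Fin 3 → ℤ),
    a m' j * (dsym j (Prod.snd m - Prod.snd m') * b (m - m') p)) : EuclideanSpace ℂ (Fin 3))

/-- Local notation: division by the weight. -/
local notation:max "𝐜" x:max => (fun mm : ℤ × (Fin 3 → ℤ) =>
  ((((|((Prod.fst mm : ℤ) : ℝ)| + freqNormSq (Prod.snd mm))⁻¹ : ℝ) : ℂ) • x mm))

/-- Local notation: multiplication by the weight. -/
local notation:max "𝐬" x:max => (fun mm : ℤ × (Fin 3 → ℤ) =>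
  ((((|((Prod.fst mm : ℤ) : ℝ)| + freqNormSq (Prod.snd mm)) : ℝ) : ℂ) • x mm))

/-- Local notation: the family of coefficients of `x ∈ W ⊂ ℓ²`. -/
local notation:max "𝐰" x:max =>
  (((x : lp (fun _ : ℤ × (Fin 3 → ℤ) => EuclideanSpace ℂ (Fin 3)) 2)) : ℤ × (Fin 3 → ℤ) → EuclideanSpace ℂ (Fin 3))

/-- Local notation: the extension `K ↦ c (K₀, tail K)` of a lattice family to `ℤ⁴`. -/
local notation:max "𝐄" c:max => (fun K : Fin 4 → ℤ => c ((K 0, Fin.tail K) : ℤ × (Fin 3 → ℤ)))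

/-- Local notation: the lattice family `û(n,k) = 𝓕(complexify ∘ (U − m₀))(n,k)`. -/
local notation:max "𝐮[" U ", " m₀ "]" => (fun mm : ℤ × (Fin 3 → ℤ) =>
  mFourierCoeff (EuclideanSpace.complexify ∘ fun y : UnitAddTorus (Fin 4) => U y - m₀)
    (Fin.cons (Prod.fst mm) (Prod.snd mm) : Fin 4 → ℤ))

/-- Local notation: the force family `y_F(n,k) = [k ≠ 0][n = 0] 𝓕(complexify ∘ F)(k)`. -/
local notation:max "𝐲" F:max => (fun mm : ℤ × (Fin 3 → ℤ) =>
  (ite (Prod.snd mm = 0) (0 : EuclideanSpace ℂ (Fin 3))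
    (ite (Prod.fst mm = 0) (mFourierCoeff (EuclideanSpace.complexify ∘ F) (Prod.snd mm)) 0)))

/-- Local notation: the lattice family of the orbit `u` with period `τ`. -/
local notation:max "𝐨[" τ ", " u "]" => (fun mm : ℤ × (Fin 3 → ℤ) =>
  mFourierCoeff (EuclideanSpace.complexify ∘ fun y : UnitAddTorus (Fin 4) => Torus.timeRoll τ u y - ∫ x, u 0 x)
    (Fin.cons (Prod.fst mm) (Prod.snd mm) : Fin 4 → ℤ))
/-- Local notation: the time multiplier `dₛ(n,k) = 2πi n / Λ(n,k)`. -/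
local notation "dS" => (fun mm : ℤ × (Fin 3 → ℤ) =>
  (2 * Real.pi * Complex.I * ((Prod.fst mm : ℤ) : ℂ)) * ((((|((Prod.fst mm : ℤ) : ℝ)| + freqNormSq (Prod.snd mm)) : ℝ) : ℂ))⁻¹)

/-- Local notation: the Stokes–drift multiplier `(4π²ν|k|² + 2πi m₀·k) / Λ(n,k)`. -/
local notation "dL[" ν ", " m₀ "]" => (fun mm : ℤ × (Fin 3 → ℤ) =>
  (((4 * Real.pi ^ 2 * ν * freqNormSq (Prod.snd mm) : ℝ) : ℂ) +
      2 * Real.pi * Complex.I * (∑ jj : Fin 3, ((m₀ jj : ℝ) : ℂ) * (((Prod.snd mm) jj : ℤ) : ℂ))) *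
    ((((|((Prod.fst mm : ℤ) : ℝ)| + freqNormSq (Prod.snd mm)) : ℝ) : ℂ))⁻¹)

/-- Local notation: the symbol `σ_om(n,k) = 2πiomn + 4π²ν|k|² + 2πi m₀·k`. -/
local notation "σ[" om ", " ν ", " m₀ "]" => (fun mm : ℤ × (Fin 3 → ℤ) =>
  2 * Real.pi * Complex.I * ((om : ℝ) : ℂ) * ((Prod.fst mm : ℤ) : ℂ) +
    (((4 * Real.pi ^ 2 * ν * freqNormSq (Prod.snd mm) : ℝ)) : ℂ) +
    2 * Real.pi * Complex.I * (∑ jj : Fin 3, ((m₀ jj : ℝ) : ℂ) * (((Prod.snd mm) jj : ℤ) : ℂ)))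
-- NOTATION END

variable {W : Submodule ℝ (lp (fun _ : ℤ × (Fin 3 → ℤ) => EuclideanSpace ℂ (Fin 3)) 2)}

/-! ## §3 Realisation of a lattice solution near the orbit as a classical periodic solution close to `u` -/

section Witness

variable {ν τ : ℝ} {f : UnitAddTorus (Fin 3) → EuclideanSpace ℝ (Fin 3)}
  {u : ℝ → UnitAddTorus (Fin 3) → EuclideanSpace ℝ (Fin 3)} {p : ℝ → UnitAddTorus (Fin 3) → ℝ}

variable (hW : ∀ x : lp (fun _ : ℤ × (Fin 3 → ℤ) => EuclideanSpace ℂ (Fin 3)) 2, x ∈ W ↔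
      (∀ n : ℤ, (x : ℤ × (Fin 3 → ℤ) → EuclideanSpace ℂ (Fin 3)) (n, 0) = 0) ∧
      (∀ mm : ℤ × (Fin 3 → ℤ), (∑ jj : Fin 3, ((mm.2 jj : ℤ) : ℂ) *
        ((x : ℤ × (Fin 3 → ℤ) → EuclideanSpace ℂ (Fin 3)) mm) jj) = 0) ∧
      (∀ mm : ℤ × (Fin 3 → ℤ), (x : ℤ × (Fin 3 → ℤ) → EuclideanSpace ℂ (Fin 3)) (-mm) =
        conjVec ((x : ℤ × (Fin 3 → ℤ) → EuclideanSpace ℂ (Fin 3)) mm)))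
variable {Ds L₀ : W →L[ℝ] W} (hDs : ∀ (x : W) (m : ℤ × (Fin 3 → ℤ)), (𝐰 (Ds x)) m = dS m • (𝐰 x) m)
  (hL₀ : ∀ (x : W) (m : ℤ × (Fin 3 → ℤ)), (𝐰 (L₀ x)) m = dL[ν, ∫ x, u 0 x] m • (𝐰 x) m)
variable {B : W → W → W} (hBf : ∀ (x y : W) (m : ℤ × (Fin 3 → ℤ)), (𝐰 (B x y)) m = Torus.lerayCoeff m.2 (𝐍[𝐜 (𝐰 x), 𝐜 (𝐰 y)] m))

include hW hDs hL₀ hBf in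
/-- **Realisation of a lattice solution** (the tail of `TimePeriodicLattice.persists_main`, verbatim): if `x ∈ W` solves
`om ∂ₛx + L₀x + B(x,x) = y_{f'}` with `om > 0` for a smooth divergence-free mean-zero force `f'`, then
`u'(t) = ∫u(0) + Re F_{x/Λ}(om t, ·)` is a classical `om⁻¹`-periodic solution of `NS_ν(f')` and, for every `t`,
`∫‖u'(t) − u(τ om t)‖² + ‖∇(u'(t) − u(τ om t))‖₂² ≤ 3(1 + 4π²)‖x − x₀‖²` (`x₀ = Λû` the orbit). [folklore] -/
theorem witness_of_latticeSol (hν : 0 < ν) (hsol : Torus.IsClassicalNSSolutionOn univ ν (fun _ => f) u p)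
    (hper : Function.Periodic u τ) (hf0 : HasZeroMean f)
    (x₀ : W) (hx₀ : 𝐰 x₀ = 𝐬 (𝐨[τ, u])) (x : W) {om : ℝ} (hom : 0 < om)
    {f' : UnitAddTorus (Fin 3) → EuclideanSpace ℝ (Fin 3)} (hf's : IsSmooth f') (hfd' : IsDivFree f') (hf0' : HasZeroMean f')
    (Yf' : W) (hYf' : 𝐰 Yf' = 𝐲 f') (hGx : om • Ds x + L₀ x + B x x = Yf') :
    ∃ p' : ℝ → UnitAddTorus (Fin 3) → ℝ,
      Torus.IsClassicalNSSolutionOn univ ν (fun _ => f')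
        (fun t : ℝ => fun x' : UnitAddTorus (Fin 3) =>
          (∫ x, u 0 x) + EuclideanSpace.realPart (fourierSynth (𝐄 (𝐜 (𝐰 x))) (Fin.cons (((om * t : ℝ)) : UnitAddCircle) x'))) p' ∧
      Function.Periodic (fun t : ℝ => fun x' : UnitAddTorus (Fin 3) =>
          (∫ x, u 0 x) + EuclideanSpace.realPart (fourierSynth (𝐄 (𝐜 (𝐰 x))) (Fin.cons (((om * t : ℝ)) : UnitAddCircle) x'))) om⁻¹ ∧
      ∀ t, (∫ x', ‖((∫ x, u 0 x) + EuclideanSpace.realPart (fourierSynth (𝐄 (𝐜 (𝐰 x)))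
          (Fin.cons (((om * t : ℝ)) : UnitAddCircle) x'))) - u (τ / om⁻¹ * t) x'‖ ^ 2) +
        Torus.gradNormSq (fun x' => ((∫ x, u 0 x) + EuclideanSpace.realPart (fourierSynth (𝐄 (𝐜 (𝐰 x)))
          (Fin.cons (((om * t : ℝ)) : UnitAddCircle) x'))) - u (τ / om⁻¹ * t) x') ≤
        (3 * (1 + 4 * Real.pi ^ 2)) * ‖x - x₀‖ ^ 2 := by
  -- the orbit data
  have hU : IsSmooth (timeRoll τ u) := orbit_isSmooth hsol hper
  have hu0 : ∀ n : ℤ, 𝐨[τ, u] ((n, 0) : ℤ × (Fin 3 → ℤ)) = 0 := orbit_zero_modes hsol hper hf0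
  have hur := orbit_rapidDecay hsol hper
  have hmomx₀ : ∀ N : ℕ, ∑' m : ℤ × (Fin 3 → ℤ), ENNReal.ofReal ((Λ m) ^ N) * ‖(𝐬 (𝐨[τ, u])) m‖ₑ ^ 2 ≠ ⊤ := fun N =>
    moments_of_rapidDecay (C := mFourierCoeff (complexify ∘ fun y => timeRoll τ u y - ∫ x, u 0 x)) hur N
  have hcx₀ : 𝐜 (𝐰 x₀) = 𝐨[τ, u] := by rw [hx₀]; exact cw_sw (x := 𝐨[τ, u]) hu0
  -- the unscaled family `c = x/Λ`
  have hc0 : ∀ n : ℤ, (𝐜 (𝐰 x)) (n, 0) = 0 := cw_zero_mode (W_zero hW x)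
  have hct : ∀ mm : ℤ × (Fin 3 → ℤ), (∑ jj : Fin 3, ((mm.2 jj : ℤ) : ℂ) * ((𝐜 (𝐰 x)) mm) jj) = 0 :=
    cw_transversal (W_trans hW x)
  have hcs : ∀ mm : ℤ × (Fin 3 → ℤ), (𝐜 (𝐰 x)) (-mm) = conjVec ((𝐜 (𝐰 x)) mm) := cw_neg (W_conj hW x)
  have hceq : ∀ m : ℤ × (Fin 3 → ℤ), m.2 ≠ 0 →
      (2 * Real.pi * Complex.I * (om : ℂ) * (m.1 : ℂ) + ((4 * Real.pi ^ 2 * ν * freqNormSq m.2 : ℝ) : ℂ) +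
          2 * Real.pi * Complex.I * (∑ jj : Fin 3, ((((∫ x, u 0 x) : EuclideanSpace ℝ (Fin 3)) jj : ℝ) : ℂ) * ((m.2 jj : ℤ) : ℂ))) •
          (𝐜 (𝐰 x)) m +
        Torus.lerayCoeff m.2 (𝐍[𝐜 (𝐰 x), 𝐜 (𝐰 x)] m) = if m.1 = 0 then mFourierCoeff (complexify ∘ f') m.2 else 0 := by
    intro m hm
    have h1 := congrArg (fun z : W => (𝐰 z) m) hGx
    simp only at h1
    rw [coord_G hDs hL₀ hBf x om m, hYf', yf_of_snd_ne_zero f' hm] at h1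
    exact h1
  -- regularity of `c`
  obtain ⟨c₂, hc₂, hcl₂⟩ := exists_symbol_lower_bound hom hν (∫ x, u 0 x)
  have hmomX₀ : ∀ N : ℕ, ∑' m, ENNReal.ofReal ((Λ m) ^ N) * ‖(𝐰 x₀) m‖ₑ ^ 2 ≠ ⊤ := by
    intro N; rw [hx₀]; exact hmomx₀ N
  have hineq : ∀ m : ℤ × (Fin 3 → ℤ), m.2 ≠ 0 →
      c₂ * ‖(𝐰 x) m‖ ≤ ‖(𝐲 f') m‖ + ‖𝐍[𝐜 (𝐰 x), 𝐜 (𝐰 x)] m‖ + ‖𝐍[𝐜 (𝐰 x₀), 𝐜 (𝐰 x)] m‖ +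
        ‖𝐍[𝐜 (𝐰 x), 𝐜 (𝐰 x₀)] m‖ := by
    intro m hm
    have he := hceq m hm
    have hL : (Λ m) ≠ 0 := ne_of_gt (lt_of_lt_of_le one_pos (one_le_wt hm))
    have hxm : ‖(𝐰 x) m‖ = Λ m * ‖(𝐜 (𝐰 x)) m‖ := by
      have e1 : ‖(𝐜 (𝐰 x)) m‖ = (Λ m)⁻¹ * ‖(𝐰 x) m‖ := by
        change ‖((((Λ m)⁻¹ : ℝ)) : ℂ) • (𝐰 x) m‖ = _
        rw [norm_smul, Complex.norm_real, Real.norm_of_nonneg (inv_nonneg.2 (wt_nonneg m))]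
      rw [e1, ← mul_assoc, mul_inv_cancel₀ hL, one_mul]
    have hσ := hcl₂ m hm
    have h1 : ‖σ[om, ν, ∫ x, u 0 x] m • (𝐜 (𝐰 x)) m‖ ≤ ‖(𝐲 f') m‖ + ‖𝐍[𝐜 (𝐰 x), 𝐜 (𝐰 x)] m‖ := by
      rw [show σ[om, ν, ∫ x, u 0 x] m • (𝐜 (𝐰 x)) m = (𝐲 f') m - Torus.lerayCoeff m.2 (𝐍[𝐜 (𝐰 x), 𝐜 (𝐰 x)] m) by
        rw [yf_of_snd_ne_zero f' hm, ← he]; exact (add_sub_cancel_right _ _).symm]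
      exact (norm_sub_le _ _).trans (add_le_add le_rfl (SteadyLattice.norm_lerayCoeff_le _ _))
    rw [norm_smul] at h1
    have h0 : 0 ≤ ‖𝐍[𝐜 (𝐰 x₀), 𝐜 (𝐰 x)] m‖ := norm_nonneg _
    have h0' : 0 ≤ ‖𝐍[𝐜 (𝐰 x), 𝐜 (𝐰 x₀)] m‖ := norm_nonneg _
    calc c₂ * ‖(𝐰 x) m‖ = (c₂ * Λ m) * ‖(𝐜 (𝐰 x)) m‖ := by rw [hxm]; ring
      _ ≤ ‖σ[om, ν, ∫ x, u 0 x] m‖ * ‖(𝐜 (𝐰 x)) m‖ := mul_le_mul_of_nonneg_right hσ (norm_nonneg _)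
      _ ≤ _ := by linarith
  have hmomc := moments_of_lattice_ineq hc₂ (𝐰 x) (𝐰 x₀) (𝐲 f') (W_zero hW x) (W_zero hW x₀) (l2_tsum_enorm_sq_ne_top _)
    hmomX₀ (tsum_moment_yf_ne_top hf's) hineq
  have hcr : RapidDecay (𝐄 (𝐜 (𝐰 x))) := rapidDecay_of_moments (W_zero hW x) hmomc
  -- realization
  obtain ⟨p', hsol', hper'⟩ := realize_nonlinear (ν := ν) (m₀ := ∫ x, u 0 x) (F := f') (c := 𝐜 (𝐰 x)) hom hf's hfd' hf0'
    hc0 hct hcs hcr hceq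
  refine ⟨p', hsol', hper', fun t => ?_⟩
  -- the closeness estimate via the slice `H¹` bound
  obtain ⟨hV's, -, hVcoef⟩ := realSynth_spec' hcr (ext_neg_eq_conjVec (c := 𝐜 (𝐰 x)) hcs)
  obtain ⟨D, hDdef⟩ : ∃ D : UnitAddTorus (Fin 4) → EuclideanSpace ℝ (Fin 3),
      D = fun y => EuclideanSpace.realPart (fourierSynth (𝐄 (𝐜 (𝐰 x))) y) - (timeRoll τ u y - ∫ x, u 0 x) := ⟨_, rfl⟩
  have hV : IsSmooth (fun y => timeRoll τ u y - ∫ x, u 0 x) := hU.sub (isSmooth_const _)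
  have hD : IsSmooth D := by rw [hDdef]; exact hV's.sub hV
  have he0 : ∀ n : ℤ, (𝐰 ((x - x₀ : W))) (n, 0) = 0 := W_zero hW _
  have he2 : ∑' m, ‖(𝐰 ((x - x₀ : W))) m‖ₑ ^ 2 ≠ ⊤ := l2_tsum_enorm_sq_ne_top _
  have he : ∀ m : ℤ × (Fin 3 → ℤ), mFourierCoeff (complexify ∘ D) (Fin.cons m.1 m.2) = (𝐜 (𝐰 ((x - x₀ : W)))) m := by
    intro m
    have hsplit : (complexify ∘ D) = (complexify ∘ fun y => EuclideanSpace.realPart (fourierSynth (𝐄 (𝐜 (𝐰 x))) y)) -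
        (complexify ∘ fun y => timeRoll τ u y - ∫ x, u 0 x) := by
      funext y; simp [hDdef]
    have hVc : IsSmooth (complexify ∘ fun y => timeRoll τ u y - ∫ x, u 0 x) := hV.comp_clm complexify.toContinuousLinearMap
    have hRc : IsSmooth (complexify ∘ fun y => EuclideanSpace.realPart (fourierSynth (𝐄 (𝐜 (𝐰 x))) y)) :=
      hV's.comp_clm complexify.toContinuousLinearMap
    rw [hsplit, mFourierCoeff_sub hRc.integrable hVc.integrable, hVcoef, coeW_sub]
    have e1 := congrArg (fun F : ℤ × (Fin 3 → ℤ) → EuclideanSpace ℂ (Fin 3) => F m) hcx₀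
    simp only at e1
    simp only [Fin.cons_zero, Fin.tail_cons, Prod.mk.eta, Pi.sub_apply, smul_sub]
    rw [← e1]
  have hbound := slice_h1_le hD (𝐰 ((x - x₀ : W))) he0 he he2 (((om * t : ℝ)) : UnitAddCircle)
  have hnorm : (∑' m, ‖(𝐰 ((x - x₀ : W))) m‖ₑ ^ 2).toReal = ‖x - x₀‖ ^ 2 := tsum_enorm_sq_toReal_eq _
  rw [hnorm] at hbound
  -- identify the slice with `u'(t) − u(τ/τ' t)`
  have hfun : (fun x' : UnitAddTorus (Fin 3) => ((∫ x, u 0 x) + EuclideanSpace.realPart (fourierSynth (𝐄 (𝐜 (𝐰 x)))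
      (Fin.cons (((om * t : ℝ)) : UnitAddCircle) x'))) - u (τ / om⁻¹ * t) x') = timeSlice D (((om * t : ℝ)) : UnitAddCircle) := by
    funext x'
    rw [timeSlice_apply, hDdef]
    simp only
    rw [timeRoll_cons hper (om * t) x', show τ / om⁻¹ * t = τ * (om * t) by rw [div_inv_eq_mul, mul_assoc]]
    abel
  calc (∫ x', ‖((∫ x, u 0 x) + EuclideanSpace.realPart (fourierSynth (𝐄 (𝐜 (𝐰 x)))
          (Fin.cons (((om * t : ℝ)) : UnitAddCircle) x'))) - u (τ / om⁻¹ * t) x'‖ ^ 2) +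
        Torus.gradNormSq (fun x' => ((∫ x, u 0 x) + EuclideanSpace.realPart (fourierSynth (𝐄 (𝐜 (𝐰 x)))
          (Fin.cons (((om * t : ℝ)) : UnitAddCircle) x'))) - u (τ / om⁻¹ * t) x')
      = (∫ x', ‖timeSlice D (((om * t : ℝ)) : UnitAddCircle) x'‖ ^ 2) +
          Torus.gradNormSq (timeSlice D (((om * t : ℝ)) : UnitAddCircle)) := by
        rw [← hfun]
    _ ≤ (3 * (1 + 4 * Real.pi ^ 2)) * ‖x - x₀‖ ^ 2 := hbound

end Witness

/-! ## §4 The kernel of the free-period linearisation: lattice solutions are real combinations of `g` and `k_v` -/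

section Kernel

variable {ν τ : ℝ} {f : UnitAddTorus (Fin 3) → EuclideanSpace ℝ (Fin 3)}
  {u v : ℝ → UnitAddTorus (Fin 3) → EuclideanSpace ℝ (Fin 3)} {p : ℝ → UnitAddTorus (Fin 3) → ℝ}

variable (hW : ∀ x : lp (fun _ : ℤ × (Fin 3 → ℤ) => EuclideanSpace ℂ (Fin 3)) 2, x ∈ W ↔
      (∀ n : ℤ, (x : ℤ × (Fin 3 → ℤ) → EuclideanSpace ℂ (Fin 3)) (n, 0) = 0) ∧
      (∀ mm : ℤ × (Fin 3 → ℤ), (∑ jj : Fin 3, ((mm.2 jj : ℤ) : ℂ) *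
        ((x : ℤ × (Fin 3 → ℤ) → EuclideanSpace ℂ (Fin 3)) mm) jj) = 0) ∧
      (∀ mm : ℤ × (Fin 3 → ℤ), (x : ℤ × (Fin 3 → ℤ) → EuclideanSpace ℂ (Fin 3)) (-mm) =
        conjVec ((x : ℤ × (Fin 3 → ℤ) → EuclideanSpace ℂ (Fin 3)) mm)))
variable {Ds L₀ : W →L[ℝ] W} (hDs : ∀ (x : W) (m : ℤ × (Fin 3 → ℤ)), (𝐰 (Ds x)) m = dS m • (𝐰 x) m)
  (hL₀ : ∀ (x : W) (m : ℤ × (Fin 3 → ℤ)), (𝐰 (L₀ x)) m = dL[ν, ∫ x, u 0 x] m • (𝐰 x) m)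
variable {B : W → W → W} (hBf : ∀ (x y : W) (m : ℤ × (Fin 3 → ℤ)), (𝐰 (B x y)) m = Torus.lerayCoeff m.2 (𝐍[𝐜 (𝐰 x), 𝐜 (𝐰 y)] m))

include hDs in
/-- **Coefficients of `−μ ∂ₛx₀`**: `(−μ) (2πi n) û(n,k)` (pattern of `range_condition`). [folklore] -/
theorem coe_smul_Ds_orbit (hsol : Torus.IsClassicalNSSolutionOn univ ν (fun _ => f) u p) (hper : Function.Periodic u τ)
    (hf0 : HasZeroMean f) (x₀ : W) (hx₀ : 𝐰 x₀ = 𝐬 (𝐨[τ, u])) (μ : ℝ) (m : ℤ × (Fin 3 → ℤ)) :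
    (𝐰 ((μ • Ds x₀ : W))) m = (μ : ℂ) • ((2 * Real.pi * Complex.I * (m.1 : ℂ)) • 𝐨[τ, u] m) := by
  have hu0 := orbit_zero_modes hsol hper hf0
  rw [coeW_smul, Pi.smul_apply, hDs, hx₀, ← Complex.coe_smul]
  congr 1
  by_cases hm : m.2 = 0
  · have h0 : 𝐨[τ, u] m = 0 := by
      have := hu0 m.1; rwa [show ((m.1, 0) : ℤ × (Fin 3 → ℤ)) = m from Prod.ext rfl hm.symm] at this
    simp only [h0, smul_zero]
  · have hL : ((((Λ m)) : ℝ) : ℂ) ≠ 0 := by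
      exact_mod_cast ne_of_gt (lt_of_lt_of_le one_pos (one_le_wt hm))
    simp only [smul_smul]
    congr 1
    field_simp

include hW hDs hL₀ hBf in
/-- **Kernel decomposition** (Iooss 1972 §3; Henry 1981 Thm. 8.3.2; Kielhöfer 2012 §I.12, on the Fourier side).  Under the
classical SIMPLE-DEGENERACY hypothesis — every `τ`-periodic classical solution of the linearised problem forced by a complex
multiple of `∂ₜu` is a combination `z₁ ∂ₜu + z₂ v` of `∂ₜu ≢ 0` and a real admissible `τ`-periodic field `v` that is not a
multiple of `∂ₜu` — every lattice solution `h ∈ W` of `τ⁻¹∂ₛh + L₀h + B(x₀,h) + B(h,x₀) = −μ ∂ₛx₀` is a REAL combination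
`a g + b k_v` of the phase vector `g = (2πi n) x₀` and the weighted state vector `k_v = Λ v̂`. [folklore] -/
theorem ker_decomp (hν : 0 < ν) (hτ : 0 < τ) (hsol : Torus.IsClassicalNSSolutionOn univ ν (fun _ => f) u p)
    (hper : Function.Periodic u τ) (hf0 : HasZeroMean f)
    (hmov : ∃ t x, Torus.timeDerivWithin univ u t x ≠ 0)
    (hsv : IsSmoothSpaceTimeOn univ v) (hperv : Function.Periodic v τ) (hvdiv : ∀ t, IsDivFree (v t))
    (hv0 : ∀ t, HasZeroMean (v t))
    (hdeg : ¬ ∃ z : ℂ, ∀ t x, Torus.realToComplex (v t x) = z • velocityDot u t x)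
    (hker : ∀ (w : ℝ → UnitAddTorus (Fin 3) → EuclideanSpace ℂ (Fin 3)) (β : ℂ),
      w ∈ linPeriodicSol ν u τ (fun t x => β • velocityDot u t x) →
        ∃ z₁ z₂ : ℂ, ∀ t x, w t x = z₁ • velocityDot u t x + z₂ • Torus.realToComplex (v t x))
    (x₀ : W) (hx₀ : 𝐰 x₀ = 𝐬 (𝐨[τ, u])) (g : W)
    (hg : 𝐰 g = fun mm : ℤ × (Fin 3 → ℤ) => (2 * Real.pi * Complex.I * (mm.1 : ℂ)) • (𝐬 (𝐨[τ, u])) mm)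
    (kv : W) (hkv : 𝐰 kv = 𝐬 (𝐮[timeRoll τ v, 0]))
    (h : W) (μ : ℝ) (heqW : τ⁻¹ • Ds h + L₀ h + (B x₀ h + B h x₀) = (-μ) • Ds x₀) :
    ∃ a b : ℝ, h = a • g + b • kv := by
  have hU : IsSmooth (timeRoll τ u) := orbit_isSmooth hsol hper
  have hu0 := orbit_zero_modes hsol hper hf0
  have hut := orbit_transversal hsol hper
  -- §a the right-hand side and the linear core
  have hY : ∀ m, (𝐰 (((-μ) • Ds x₀ : W))) m = ((-μ : ℝ) : ℂ) • ((2 * Real.pi * Complex.I * (m.1 : ℂ)) • 𝐨[τ, u] m) :=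
    fun m => by rw [coe_smul_Ds_orbit hDs hsol hper hf0 x₀ hx₀ (-μ) m, Complex.ofReal_neg]
  obtain ⟨heq, hhr⟩ := linear_core hW hDs hL₀ hBf hν hτ hsol hper hf0 x₀ hx₀ h ((-μ) • Ds x₀) (b := ((-μ : ℝ) : ℂ)) hY heqW
  have hh0 : ∀ n : ℤ, (𝐜 (𝐰 h)) (n, 0) = 0 := cw_zero_mode (W_zero hW h)
  have hht : ∀ mm : ℤ × (Fin 3 → ℤ), (∑ jj : Fin 3, ((mm.2 jj : ℤ) : ℂ) * ((𝐜 (𝐰 h)) mm) jj) = 0 :=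
    cw_transversal (W_trans hW h)
  -- §b classical realisation of `h` and the simple-degeneracy hypothesis
  obtain ⟨Q, hQ, hE⟩ := linear_rolledUp_of_coeff (U := timeRoll τ u) (m₀ := ∫ x, u 0 x) (h := 𝐜 (𝐰 h))
    (b := ((-μ : ℝ) : ℂ)) hU hu0 hut hh0 hht hhr heq
  obtain ⟨hsw, hsq, hdivC, hmeanC, hperw, hEq⟩ := linear_classical (ν := ν) hτ hsol.smooth_velocity hper
    hhr.isSmooth_fourierSynth hQ hE (div_synth_eq_zero (h := 𝐜 (𝐰 h)) hht hhr)
    (integral_timeSlice_synth_eq_zero (h := 𝐜 (𝐰 h)) hh0 hhr)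
  have hmem : (fun t : ℝ => fun x : UnitAddTorus (Fin 3) => fourierSynth (𝐄 (𝐜 (𝐰 h))) (Fin.cons (((τ⁻¹ * t : ℝ)) : UnitAddCircle) x)) ∈
      linPeriodicSol ν u τ (fun t x => (((-μ : ℝ) : ℂ) * (τ : ℂ)) • velocityDot u t x) :=
    ⟨hsw, hdivC, hmeanC, hperw, _, hsq, fun t x => hEq t x⟩
  obtain ⟨z₁, z₂, hz⟩ := hker _ _ hmem
  -- §c identification of the coefficients: `𝐰 h = c₁ • 𝐰 g + z₂ • 𝐰 kv` coordinatewise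
  have hcoef := coeff_eq_of_synth_eq_lincomb (h := 𝐜 (𝐰 h)) hτ hsol.smooth_velocity hper hsv hperv hhr (∫ x, u 0 x) hz
  have hwc : ∀ m, (𝐰 h) m = (z₁ * ((τ⁻¹ : ℝ) : ℂ)) • (𝐰 g) m + z₂ • (𝐰 kv) m := by
    intro m
    have e1 := congrArg (fun F : ℤ × (Fin 3 → ℤ) → EuclideanSpace ℂ (Fin 3) => F m) (sw_cw (x := 𝐰 h) (W_zero hW h))
    simp only at e1
    rw [← e1, hcoef m, hg, hkv]
    simp only [smul_add, smul_smul]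
    congr 1 <;> congr 1 <;> ring
  -- §d reality of the two coefficients (conjugate symmetry at the unweighted level + independence)
  obtain ⟨-, -, hvc, -⟩ := fieldFamily_admissible (τ := τ) (Z := v) hsv hperv hvdiv hv0
  have hPc : ∀ m : ℤ × (Fin 3 → ℤ), (2 * Real.pi * Complex.I * ((-m).1 : ℂ)) • 𝐨[τ, u] (-m) =
      conjVec ((2 * Real.pi * Complex.I * (m.1 : ℂ)) • 𝐨[τ, u] m) := fun m => by
    have := nsmul_neg (x := 𝐨[τ, u]) (orbit_conj hsol hper) m
    simpa only using this
  have hhc : ∀ m : ℤ × (Fin 3 → ℤ), (𝐜 (𝐰 h)) (-m) = conjVec ((𝐜 (𝐰 h)) m) := cw_neg (W_conj hW h)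
  set c₁ : ℂ := z₁ * ((τ⁻¹ : ℝ) : ℂ) with hc₁
  have hcoef' : ∀ m : ℤ × (Fin 3 → ℤ), (𝐜 (𝐰 h)) m = c₁ • ((2 * Real.pi * Complex.I * (m.1 : ℂ)) • 𝐨[τ, u] m) +
      z₂ • 𝐮[timeRoll τ v, 0] m := fun m => by
    rw [smul_smul]; exact hcoef m
  have hcomb : ∀ m : ℤ × (Fin 3 → ℤ), (c₁ - conj c₁) • ((2 * Real.pi * Complex.I * (m.1 : ℂ)) • 𝐨[τ, u] m) +
      (z₂ - conj z₂) • 𝐮[timeRoll τ v, 0] m = 0 := by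
    -- the identity at `−m` and the conjugate of the identity at `m` both express `(h/Λ)(−m)`; subtract
    have e3 : ∀ m : ℤ × (Fin 3 → ℤ), (c₁ - conj c₁) • ((2 * Real.pi * Complex.I * ((-m).1 : ℂ)) • 𝐨[τ, u] (-m)) +
        (z₂ - conj z₂) • 𝐮[timeRoll τ v, 0] (-m) = 0 := by
      intro m
      have f1 := hcoef' (-m)
      have f2 := congrArg conjVec (hcoef' m)
      rw [← hhc m, conjVec_add, conjVec_smul c₁, conjVec_smul z₂, ← hPc m, ← hvc m] at f2
      rw [sub_smul, sub_smul]
      have := f1.symm.trans f2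
      rw [← sub_eq_zero] at this
      rw [← this]; abel
    intro m
    have := e3 (-m)
    simpa only [neg_neg] using this
  obtain ⟨hre₁, hre₂⟩ := eq_zero_of_lincomb_family_eq_zero (u := u) (v := v) hτ hsol.smooth_velocity hper hsv hperv
    (∫ x, u 0 x) hmov hdeg hcomb
  have hc₁r : ((c₁.re : ℝ) : ℂ) = c₁ := Complex.conj_eq_iff_re.1 (sub_eq_zero.1 hre₁).symm
  have hz₂r : ((z₂.re : ℝ) : ℂ) = z₂ := Complex.conj_eq_iff_re.1 (sub_eq_zero.1 hre₂).symm
  -- §e conclusion in `W`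
  refine ⟨c₁.re, z₂.re, W_ext fun m => ?_⟩
  rw [coeW_add, coeW_smul, coeW_smul, Pi.add_apply, Pi.smul_apply, Pi.smul_apply, ← Complex.coe_smul, ← Complex.coe_smul,
    hc₁r, hz₂r]
  exact hwc m

end Kernel

/-! ## Registered part B (abstract, notation-free) -/
section Abstract

/-- **Registered sub-goal `lsFamilyPeriodic_partB`** (companion c3): THE KERNEL IS A LINE.  Abstract real linear algebra behind
the free-period bordering: if every solution `(h, μ)` of `T h + μ a = 0` decomposes as `h = α g + β k`, `a ≠ 0`, and the phase
functional sees `g` (`φ g ≠ 0`), then the solutions of `T h + μ a = 0`, `φ h = 0` form the line through any non-zero one of them.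
[folklore] -/
theorem lsFamilyPeriodic_partB : ∀ (E : Type) [AddCommGroup E] [Module ℝ E] (T : E →ₗ[ℝ] E) (φ : E →ₗ[ℝ] ℝ) (a g kv : E) (gh : E × ℝ), a ≠ 0 → φ g ≠ 0 → (∀ (h : E) (μ : ℝ), T h + μ • a = 0 → ∃ α β : ℝ, h = α • g + β • kv) → T gh.1 + gh.2 • a = 0 → φ gh.1 = 0 → gh ≠ 0 → ∀ q : E × ℝ, T q.1 + q.2 • a = 0 → φ q.1 = 0 → ∃ z : ℝ, q = z • gh := by
  intro E _ _ T φ a g kv gh ha hφ hdec hghT hφgh hgh0 q hq1 hq2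
  obtain ⟨ag, bg, hgdec⟩ := hdec gh.1 gh.2 hghT
  have hbg : bg ≠ 0 := by
    intro hbg
    rw [hbg, zero_smul, add_zero] at hgdec
    have hag : ag = 0 := by
      have h1 := hφgh; rw [hgdec, map_smul, smul_eq_mul] at h1
      rcases mul_eq_zero.1 h1 with h2 | h2
      · exact h2
      · exact absurd h2 hφ
    have hg1 : gh.1 = 0 := by rw [hgdec, hag, zero_smul]
    have hg2 : gh.2 = 0 := by
      have := hghT; rw [hg1, map_zero, zero_add] at this
      rcases smul_eq_zero.1 this with h2 | h2
      · exact h2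
      · exact absurd h2 ha
    exact hgh0 (Prod.ext hg1 hg2)
  have hφkv : φ kv = -(ag * φ g) / bg := by
    have h1 := hφgh; rw [hgdec, map_add, map_smul, map_smul, smul_eq_mul, smul_eq_mul] at h1
    field_simp; linarith
  obtain ⟨α, β, hhd⟩ := hdec q.1 q.2 hq1
  have hα : α = β / bg * ag := by
    have h1 := hq2; rw [hhd, map_add, map_smul, map_smul, smul_eq_mul, smul_eq_mul, hφkv] at h1
    field_simp at h1
    have h3 : (α * bg - β * ag) * φ g = 0 := by linarith
    rcases mul_eq_zero.1 h3 with h4 | h4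
    · field_simp; linarith
    · exact absurd h4 hφ
  have hfirst : q.1 = (β / bg) • gh.1 := by
    rw [hhd, hgdec, smul_add, smul_smul, smul_smul, hα, div_mul_cancel₀ β hbg]
  refine ⟨β / bg, Prod.ext hfirst ?_⟩
  show q.2 = (β / bg) • gh.2
  have h1 : (q.2 - (β / bg) * gh.2) • a = 0 := by
    rw [sub_smul, mul_smul]
    have e1 : q.2 • a = -T q.1 := eq_neg_of_add_eq_zero_right hq1
    have e2 : gh.2 • a = -T gh.1 := eq_neg_of_add_eq_zero_right hghT
    rw [e1, e2, hfirst, map_smul, smul_neg, sub_self]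
  rcases smul_eq_zero.1 h1 with h2 | h2
  · rw [smul_eq_mul]; linarith
  · exact absurd h2 ha

end Abstract
end Summit.AnomalousDissipation.AnomalousDissipation.Theorems.RobustLoudUpgrade.LsFamilyPeriodic

end
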